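import Literature.NumberTheory.ComplexMultiplication.EllipticUnits.ImaginaryQuadraticMainConjectureCarriersLevels
import Literature.NumberTheory.GaloisRepresentations.ContinuousCorestrictionComp
import Literature.NumberTheory.GaloisRepresentations.CorestrictionTransferComparison
import Literature.NumberTheory.GaloisRepresentations.CorNaturality
import HarnessLib

/-!
# The corestrictions `cor_{F'/F}` between the level groups `H^i(G_S(F), μ_{p^k} ⊗ θ)` of
# Johnson-Leung–Kings 2011 Def. 4.2 (94): transitivity, equivariance, compatibility with reduction

Topic `Literature/NumberTheory/ComplexMultiplication/EllipticUnits` (grouping sub-namespace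
`JohnsonLeungKings2011`). Width seat `bsd-line-cf2-p1-w5` g9 (cell `bsd-print-cf2`), piece (G2) of the
cell's construction (M1)/F0b — the three properties of ty2 g37's relative corestrictions `relCores`
(`ImaginaryQuadraticMainConjectureCarriers.lean`) that the zeta pins (Z1)/(Z2) of `TwistedIwasawaData`
consume when a norm-compatible system of twisted Kummer classes living on Kato's levels `K(p^s𝔣)` is
pushed to the `ℤ_p²`-layers `K̃_n`. Theorems only; no definition, no named fact, no `instance`, no `sorry`.

* **`relCores_one_eq_coresLe`** — in degree `1`, `relCores` IS the tree's transfer corestriction `coresLe`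
  of the ONE ambient `G_S`-module `(coeffGS p S θ k).toTopRep` (the tree's `cores_eq_cor`, Serre I §2.5 =
  NSW I §5 on cochains), so that every `coresLe`-currency statement of the cell (Kummer ∘ norm, -w6 g8)
  applies to `relCores` by rewriting;
* **`relCores_relCores_one`** — TRANSITIVITY `cor_{F'/F} ∘ cor_{F''/F'} = cor_{F''/F}` in degree `1`
  (the tree's `coresLe_comp`, NSW Prop. 1.5.3 (iii));
* **`relCores_levelConj`** — EQUIVARIANCE `cor_{F'/F} ∘ (γ ·) = (γ ·) ∘ cor_{F'/F}` for every `γ ∈ Γ_K`, all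
  degrees, `F, F'` Galois over `K` (the tree's `relCor_conjMap`; part I's `layerCores_layerConj` is the
  case of two consecutive layers);
* **`relCores_levelRed_succ`** — COMPATIBILITY WITH THE REDUCTION `μ_{p^{k+1}} ⊗ θ → μ_{p^k} ⊗ θ` in
  positive degrees (naturality of `cor` in the coefficients, the tree's `cor_cohomologyMap`, NSW Prop. 1.5.2;
  with `toSubgroupOf_map_levelRedHom`, the naturality of the tautological comparison); the case of two
  consecutive layers is the commutation `layerCores ∘ layerRed = layerRed ∘ layerCores`
  (**`layerCores_layerRed_succ`**).

## References
* [JohnsonLeungKings2011] J. Johnson-Leung, G. Kings, J. reine angew. Math. 653 (2011) = arXiv:0804.2828,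
  Def. 4.2 (94) (p0012:L94), Def. 3.5 (p0010:L72–80: the traces `tr_{K(𝔪)/F}` and their transitivity).
* [NeukirchSchmidtWingberg2008] J. Neukirch, A. Schmidt, K. Wingberg, *Cohomology of Number Fields*, I §5
  Prop. 1.5.2, Prop. 1.5.3 (iii), Prop. 1.5.4.
* [SerreGaloisCohomology1997] J.-P. Serre, *Galois Cohomology*, I §2.5.
* [Kato2004Asterisque] K. Kato, Astérisque 295 (2004), §8.2 (p. 180).
-/

noncomputable section

open scoped NumberField
open CategoryTheory Field IsDedekindDomain
open Literature.NumberTheory.GaloisRepresentations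
open Literature.NumberTheory.GaloisRepresentations.DiscreteGaloisModule
open Literature.NumberTheory.EllipticCurves

universe v u

namespace Literature.NumberTheory.ComplexMultiplication.EllipticUnits.JohnsonLeungKings2011

variable {K : Type} [Field K] [NumberField K] (p : ℕ) [Fact p.Prime]
  (S : Set (HeightOneSpectrum (𝓞 K))) (θ : absoluteGaloisGroup K →ₜ* ℤ_[p]ˣ)

/-! ## §1 Small supplements on the image groups `U_S = imGS S U` -/

omit [NumberField K] in
/-- `imGS` is monotone (public copy of the carriers file's private lemma). [cite: JohnsonLeungKings2011, §2.1 (arXiv p0006:L10–12)] -/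
theorem imGS_le_of_le {U U' : Subgroup (absoluteGaloisGroup K)} (h : U' ≤ U) : imGS S U' ≤ imGS S U :=
  Subgroup.map_mono h

omit [NumberField K] in
/-- The image of an open subgroup is open (`Γ_K ↠ G_S` is an open map; public copy).
[cite: JohnsonLeungKings2011, §2.1 (arXiv p0006:L10–12)] -/
theorem isOpen_imGS_of_isOpen {U : Subgroup (absoluteGaloisGroup K)} (hU : IsOpen (U : Set (absoluteGaloisGroup K))) :
    IsOpen (imGS S U : Set (GaloisGroupUnramifiedOutside K S)) :=
  isOpenMap_toUnramifiedQuot K S _ hU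

/-! ## §2 Degree one: `relCores = coresLe`, and transitivity -/

section DegreeOne

variable {U U' U'' : Subgroup (absoluteGaloisGroup K)}

/-- **In degree `1`, `relCores` is the transfer corestriction `coresLe`** of the ONE ambient `G_S`-module
`(coeffGS p S θ k).toTopRep` along `imGS S U' ≤ imGS S U` (the tree's `cores_eq_cor`: on `H¹` the Shapiro
corestriction equals the explicit transfer on cocycles), for ANY `Fintype` instance on the index set.
[cite: SerreGaloisCohomology1997, I §2.5] [cite: NeukirchSchmidtWingberg2008, I §5 Prop. 1.5.4] -/
theorem relCores_one_eq_coresLe (h : U' ≤ U) (hU : IsOpen (U : Set (absoluteGaloisGroup K)))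
    (hU' : IsOpen (U' : Set (absoluteGaloisGroup K))) (k : ℕ)
    [inst : Fintype (↥(imGS S U) ⧸ (imGS S U').subgroupOf (imGS S U))] (c : levelCoh p S θ U' k 1) :
    relCores p S θ h hU hU' k 1 c =
      coresLe (coeffGS p S θ k).toTopRep (imGS_le_of_le S h) (isOpen_imGS_of_isOpen S hU') c := by
  haveI : TotallyDisconnectedSpace (GaloisGroupUnramifiedOutside K S) :=
    Literature.GroupTheory.ProfiniteSubquotients.totallyDisconnectedSpace_quotient
      (ramificationSubgroup K S) (ramificationSubgroup_isClosed K S)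
  haveI : CompactSpace (imGS S U) := isCompact_iff_compactSpace.mp (isClosed_imGS' S hU).isCompact
  haveI : IsClosed (((imGS S U').subgroupOf (imGS S U) : Subgroup (imGS S U)) : Set (imGS S U)) :=
    (isClosed_imGS' S hU').preimage continuous_subtype_val
  haveI : ((imGS S U').subgroupOf (imGS S U)).FiniteIndex := by
    haveI := finiteIndex_imGS' S hU'
    infer_instance
  have e : inst = Fintype.ofFinite _ := Subsingleton.elim _ _
  subst e
  letI : Fintype (↥(imGS S U) ⧸ (imGS S U').subgroupOf (imGS S U)) := Fintype.ofFinite _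
  rw [coresLe, LinearMap.coe_comp, Function.comp_apply]
  exact (cores_eq_cor ((imGS S U').subgroupOf (imGS S U)) (levelRep p S θ U k)
    (isOpen_subgroupOf (imGS S U) (isOpen_imGS_of_isOpen S hU')) _).symm

/-- **Transitivity of the corestrictions in degree `1`**: `cor_{F'/F} (cor_{F''/F'} c) = cor_{F''/F} c` for
open `U'' ≤ U' ≤ U` (`U = Gal(K̄/F)` etc.) — the transitivity of the traces `tr` used in Def. 3.5 /
§5.2 ("`_𝔞ζ_{K_n}(χ) = tr_{K(𝔣_χp^{r+n})/K_n}(…)`", independent of the auxiliary level).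
[cite: NeukirchSchmidtWingberg2008, I §5 Prop. 1.5.3 (iii)] [cite: JohnsonLeungKings2011, Def. 3.5 (arXiv p0010:L72–80)] -/
theorem relCores_relCores_one (h' : U'' ≤ U') (h : U' ≤ U) (hU : IsOpen (U : Set (absoluteGaloisGroup K)))
    (hU' : IsOpen (U' : Set (absoluteGaloisGroup K))) (hU'' : IsOpen (U'' : Set (absoluteGaloisGroup K)))
    (k : ℕ) (c : levelCoh p S θ U'' k 1) :
    relCores p S θ h hU hU' k 1 (relCores p S θ h' hU' hU'' k 1 c) = relCores p S θ (h'.trans h) hU hU'' k 1 c := by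
  haveI : ((imGS S U').subgroupOf (imGS S U)).FiniteIndex := by
    haveI := finiteIndex_imGS' S hU'
    infer_instance
  haveI : ((imGS S U'').subgroupOf (imGS S U')).FiniteIndex := by
    haveI := finiteIndex_imGS' S hU''
    infer_instance
  haveI : ((imGS S U'').subgroupOf (imGS S U)).FiniteIndex := by
    haveI := finiteIndex_imGS' S hU''
    infer_instance
  letI : Fintype (↥(imGS S U) ⧸ (imGS S U').subgroupOf (imGS S U)) := Fintype.ofFinite _
  letI : Fintype (↥(imGS S U') ⧸ (imGS S U'').subgroupOf (imGS S U')) := Fintype.ofFinite _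
  letI : Fintype (↥(imGS S U) ⧸ (imGS S U'').subgroupOf (imGS S U)) := Fintype.ofFinite _
  rw [relCores_one_eq_coresLe, relCores_one_eq_coresLe, relCores_one_eq_coresLe, ← LinearMap.comp_apply,
    coresLe_comp]

end DegreeOne

/-! ## §3 Equivariance under `Γ_K` (all degrees) -/

section Conj

variable {U U' : Subgroup (absoluteGaloisGroup K)} [U.Normal] [U'.Normal]

/-- **The corestrictions intertwine the conjugation operators**: `cor_{F'/F} ∘ (γ ·) = (γ ·) ∘ cor_{F'/F}` for
`γ ∈ Γ_K`, `F ⊆ F'` Galois over `K`, all degrees (the tree's `relCor_conjMap`; ty2's `relCores` is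
`cor ∘ toSubgroupOf` on the nose). [cite: NeukirchSchmidtWingberg2008, I §5 Prop. 1.5.4] [cite: JohnsonLeungKings2011, §4.2 (arXiv p0012:L109–112)] -/
theorem relCores_levelConj (h : U' ≤ U) (hU : IsOpen (U : Set (absoluteGaloisGroup K)))
    (hU' : IsOpen (U' : Set (absoluteGaloisGroup K))) (k i : ℕ) (γ : absoluteGaloisGroup K)
    (c : levelCoh p S θ U' k i) :
    relCores p S θ h hU hU' k i (levelConj p S θ U' k i γ c) =
      levelConj p S θ U k i γ (relCores p S θ h hU hU' k i c) := by
  haveI : TotallyDisconnectedSpace (GaloisGroupUnramifiedOutside K S) :=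
    Literature.GroupTheory.ProfiniteSubquotients.totallyDisconnectedSpace_quotient
      (ramificationSubgroup K S) (ramificationSubgroup_isClosed K S)
  haveI := normal_imGS S U
  haveI := normal_imGS S U'
  haveI : IsClosed (imGS S U : Set (GaloisGroupUnramifiedOutside K S)) := isClosed_imGS' _ hU
  haveI : IsClosed (imGS S U' : Set (GaloisGroupUnramifiedOutside K S)) := isClosed_imGS' _ hU'
  haveI : ((imGS S U').subgroupOf (imGS S U)).FiniteIndex := by
    haveI := finiteIndex_imGS' S hU'
    infer_instance
  letI : Fintype (↥(imGS S U) ⧸ (imGS S U').subgroupOf (imGS S U)) := Fintype.ofFinite _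
  exact relCor_conjMap (imGS S U) (imGS S U') (coeffGS p S θ k) (toUnramifiedQuot K S γ) (Subgroup.map_mono h) i c

end Conj

/-! ## §4 Compatibility with the reduction of coefficients (positive degrees) -/

section Red

variable {U U' : Subgroup (absoluteGaloisGroup K)}

omit [NumberField K] in
/-- The tautological comparison commutes with the reduction `μ_{p^{k+1}} ⊗ θ → μ_{p^k} ⊗ θ`.
[cite: Kato2004Asterisque, §8.2 (p. 180)] [cite: NeukirchSchmidtWingberg2008, I §5 Prop. 1.5.2] -/
theorem toSubgroupOf_map_levelRedHom (h : U' ≤ U) (k i : ℕ) (c : levelCoh p S θ U' (k + 1) i) :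
    (toSubgroupOf (coeffGS p S θ k).toTopRep (imGS_le_of_le S h) i).hom
        ((ContinuousCohomology.map (ContinuousMonoidHom.id _) (levelRedHom p S θ U' k) i).hom c) =
      (cohomologyMap (resModHom ((imGS S U').subgroupOf (imGS S U)) (levelRedHom p S θ U k)) i).hom
        ((toSubgroupOf (coeffGS p S θ (k + 1)).toTopRep (imGS_le_of_le S h) i).hom c) := by
  -- the common composite `H^i(G_S(F'), μ_{p^{k+1}} ⊗ θ) → H^i(A, μ_{p^k} ⊗ θ)`, `A = G_S(F')` read inside `G_S(F)`
  let hmap : TopRep.res ((subgroupOfHom (imGS_le_of_le S h) :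
        ((imGS S U').subgroupOf (imGS S U) : Subgroup (imGS S U)) →* (imGS S U')))
        (subgroupRep (coeffGS p S θ (k + 1)).toTopRep (imGS S U')) ⟶
      subgroupRep (subgroupRep (coeffGS p S θ k).toTopRep (imGS S U)) ((imGS S U').subgroupOf (imGS S U)) :=
    TopRep.ofHom ⟨(levelRedHom p S θ U' k).hom.toContinuousLinearMap, fun x =>
      ContinuousLinearMap.ext fun v =>
        levelRedHom_equivariant p θ S U' k ((x : imGS S U) : GaloisGroupUnramifiedOutside K S) v⟩
  have h1 := map_comp_apply_of (X := subgroupRep (coeffGS p S θ (k + 1)).toTopRep (imGS S U'))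
    (Y := subgroupRep (coeffGS p S θ k).toTopRep (imGS S U'))
    (Z := subgroupRep (subgroupRep (coeffGS p S θ k).toTopRep (imGS S U)) ((imGS S U').subgroupOf (imGS S U)))
    (ContinuousMonoidHom.id _) (subgroupOfHom (imGS_le_of_le S h)) (subgroupOfHom (imGS_le_of_le S h))
    (fun _ => rfl) (levelRedHom p S θ U' k) (TopRep.ofHom ⟨ContinuousLinearMap.id ℤ _, fun _ => rfl⟩)
    hmap (fun _ => rfl) i c
  have h2 := map_comp_apply_of (X := subgroupRep (coeffGS p S θ (k + 1)).toTopRep (imGS S U'))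
    (Y := subgroupRep (subgroupRep (coeffGS p S θ (k + 1)).toTopRep (imGS S U)) ((imGS S U').subgroupOf (imGS S U)))
    (Z := subgroupRep (subgroupRep (coeffGS p S θ k).toTopRep (imGS S U)) ((imGS S U').subgroupOf (imGS S U)))
    (subgroupOfHom (imGS_le_of_le S h)) (ContinuousMonoidHom.id _) (subgroupOfHom (imGS_le_of_le S h))
    (fun _ => rfl) (TopRep.ofHom ⟨ContinuousLinearMap.id ℤ _, fun _ => rfl⟩)
    (resIdHom (resModHom ((imGS S U').subgroupOf (imGS S U)) (levelRedHom p S θ U k)))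
    hmap (fun _ => rfl) i c
  exact h1.symm.trans h2

/-- **The corestrictions commute with the reduction of coefficients** (positive degrees):
`cor_{F'/F} (red c) = red (cor_{F'/F} c)` for `c ∈ H^{i+1}(G_S(F'), μ_{p^{k+1}} ⊗ θ)` — naturality of `cor`
in the coefficient morphism `ζ ↦ ζ^p` (the tree's `cor_cohomologyMap`). [cite: NeukirchSchmidtWingberg2008, I §5 Prop. 1.5.2] [cite: Kato2004Asterisque, §8.2 (p. 180)] -/
theorem relCores_levelRed_succ (h : U' ≤ U) (hU : IsOpen (U : Set (absoluteGaloisGroup K)))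
    (hU' : IsOpen (U' : Set (absoluteGaloisGroup K))) (k i : ℕ) (c : levelCoh p S θ U' (k + 1) (i + 1)) :
    relCores p S θ h hU hU' k (i + 1) (levelRed p S θ U' k (i + 1) c) =
      levelRed p S θ U k (i + 1) (relCores p S θ h hU hU' (k + 1) (i + 1) c) := by
  haveI : TotallyDisconnectedSpace (GaloisGroupUnramifiedOutside K S) :=
    Literature.GroupTheory.ProfiniteSubquotients.totallyDisconnectedSpace_quotient
      (ramificationSubgroup K S) (ramificationSubgroup_isClosed K S)
  haveI : CompactSpace (imGS S U) := isCompact_iff_compactSpace.mp (isClosed_imGS' S hU).isCompact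
  haveI : IsClosed (((imGS S U').subgroupOf (imGS S U) : Subgroup (imGS S U)) : Set (imGS S U)) :=
    (isClosed_imGS' S hU').preimage continuous_subtype_val
  haveI : ((imGS S U').subgroupOf (imGS S U)).FiniteIndex := by
    haveI := finiteIndex_imGS' S hU'
    infer_instance
  letI : Fintype (↥(imGS S U) ⧸ (imGS S U').subgroupOf (imGS S U)) := Fintype.ofFinite _
  have hcor := cor_cohomologyMap ((imGS S U').subgroupOf (imGS S U)) (levelRep p S θ U (k + 1))
    (levelRep p S θ U k) (levelRedHom p S θ U k) i
    ((toSubgroupOf (coeffGS p S θ (k + 1)).toTopRep (imGS_le_of_le S h) (i + 1)).hom c)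
  have hT := toSubgroupOf_map_levelRedHom p S θ h k (i + 1) c
  rw [levelRed_apply, levelRed_apply]
  unfold relCores
  exact (congrArg (fun t ↦ (cor ((imGS S U').subgroupOf (imGS S U)) (levelRep p S θ U k) (i + 1)).hom t) hT).trans
    hcor

end Red

/-! ## §5 The `ℤ_p²`-layers: `layerCores ∘ layerRed = layerRed ∘ layerCores` -/

section Layers

variable (κ₁ κ₂ : ZpExtension K p) (𝔣 : Ideal (𝓞 K))

/-- **The two transition systems of `∏_{n,k} H^{i+1}(G_S(K̃_n), μ_{p^k} ⊗ θ)` commute**: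
`cor_{K̃_{n+1}/K̃_n} ∘ red = red ∘ cor_{K̃_{n+1}/K̃_n}` (positive degrees). [cite: JohnsonLeungKings2011, Def. 4.2 (94) (arXiv p0012:L94)] [cite: Kato2004Asterisque, §8.2 (p. 180)] -/
theorem layerCores_layerRed_succ (n k i : ℕ) (c : layerCoh p κ₁ κ₂ θ 𝔣 (n + 1) (k + 1) (i + 1)) :
    layerCores p κ₁ κ₂ θ 𝔣 n k (i + 1) (layerRed p κ₁ κ₂ θ 𝔣 (n + 1) k (i + 1) c) =
      layerRed p κ₁ κ₂ θ 𝔣 n k (i + 1) (layerCores p κ₁ κ₂ θ 𝔣 n (k + 1) (i + 1) c) :=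
  relCores_levelRed_succ p (suppPF p 𝔣) θ (pairLayerSubgroup_antitone κ₁ κ₂ (Nat.le_succ n))
    (isOpen_pairLayerSubgroup κ₁ κ₂ n) (isOpen_pairLayerSubgroup κ₁ κ₂ (n + 1)) k i c

end Layers

end Literature.NumberTheory.ComplexMultiplication.EllipticUnits.JohnsonLeungKings2011

end
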